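import Mathlib
import HarnessLib
import Literature.Analysis.FluidPDE.Tao2016AveragedNS.LocalCascadeSolutions
import Literature.Analysis.FluidPDE.Tao2016AveragedNS.RenormalisedCascadeWaves
import Summits.NavierStokesRegularity.NavierStokesRegularity.Theorems.TaoLadderRungTwoBreakEternalRigidityViscBddOneDefs
import Summits.NavierStokesRegularity.NavierStokesRegularity.Theorems.TaoLadderRungTwoBreakEternalRigidityViscBddOneDeepDissipation
import Summits.NavierStokesRegularity.NavierStokesRegularity.Theorems.WakeRatchetMinimalViscousBlowupClosedValve

/-!
# Crux `TaoLadderRungTwoBreak.EternalRigidityViscBddOne` (stmt-NavierStokesRegularity-20420): TYPE I ⟹ UPPER CLOCK AT THE CRITICAL FRONT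
# `ν(1+ε₀)^{2F}(t⋆−t) < K₁` and an a=1 LEVEL FLOOR there (part 2/2; part 1/2 = `…DeepDissipation`)

MODEL lattice ODEs only (Tao 2016 §4: the exact NS-scaled `ν`-viscous cascade lattice of a table of `InTableClass R`, `m = 4`, in the registered
vocabulary `ViscousUpTo` / `TypeOne` of the skeleton `85fbfe8e90eea58b`); nothing here is a statement about the Navier–Stokes equations; no stub, crux
or summit is closed (`--supports stmt-NavierStokesRegularity-20420`).

* `frontClock_of_typeOne` — `ViscousUpTo ε₀ ν α X₀ X t⋆ ∧ TypeOne ε₀ X t⋆` ⟹ `∃ K₁ > 0, ∃ t₁ < t⋆`, at every `t ∈ [t₁,t⋆)` every mode with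
  `Λ^F|X_{i,F}(t)|(t⋆−t) ≥ 1/(32(3+Λ))` (critical-front modes; they exist at every time of a blow-up, `CriticalRate.typeOne_quantity_lower_bound`)
  has covariant viscosity `ν(1+ε₀)^{2F}(t⋆−t) < K₁`: the critical front never sits deep in the dissipation range, i.e. the frame recentred at
  it (`isEternalVisc_recentre`) has BOUNDED viscosity `ν̂ < K₁` (by `DeepDissipation.renormalisedSq_lt_of_deepDissipation`);
* `frontLevel_floor_of_typeOne` — there the square root of the a=1 level obeys `(1+ε₀)^{F/2}|X_{i,F}(t)| > ν/(32(3+Λ)K₁)`: the critical front of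
  a type-I viscous blow-up is uniformly FIRED (frame-viscosity identity `ν(1+ε₀)^{2F}(t⋆−t)·(1+ε₀)^{F/2}|X| = ν·Λ^F|X|(t⋆−t)`).
READING for ⟨20420⟩ (ω4): under (ω3)'s type I the frames recentred at the critical front are uniformly bounded (type I), non-degenerate at the anchor
(minimal rate, `…CriticalRate`), have bounded covariant viscosity AND a fired anchor (this file) — the kinematic inputs of an Arzelà–Ascoli
extraction with `ν̂_j → ν̂ ∈ [0,K₁]`; admissibility (action) and (S₁)-survival of the limit remain the open, clock-type part (log-time hop clock).
HONEST LABEL: (ω3), (ω4), ⟨20420⟩ and every NS statement remain OPEN; rung 0.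
-/

noncomputable section

-- the summit and its single sub-problem share the name (CONVENTIONS §1)
set_option linter.dupNamespace false

open Set Filter Topology
open Literature.Analysis.FluidPDE Literature.Analysis.FluidPDE.TaoCascade
open Summit.NavierStokesRegularity.NavierStokesRegularity.Theorems.MinimalViscousBlowup.ThresholdRay
open Summit.NavierStokesRegularity.NavierStokesRegularity.Theorems.EternalRigidityViscBddOne.Birth
open Summit.NavierStokesRegularity.NavierStokesRegularity.Theorems.EternalRigidityViscBddOne.DeepDissipation

namespace Summit.NavierStokesRegularity.NavierStokesRegularity.Theorems.EternalRigidityViscBddOne.FrontClock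

/-! ### In the skeleton's vocabulary: the upper clock and the level floor at the critical front -/

/-- **UPPER CLOCK AT THE CRITICAL FRONT (type I).**  For a table of `InTableClass R`, `ε₀ > 0`, `ν > 0`: along
`ViscousUpTo ε₀ ν α X₀ X t⋆ ∧ TypeOne ε₀ X t⋆` there are `K₁ > 0` and `t₁ < t⋆` such that at every time `t ∈ [t₁, t⋆)` every mode
`(i, F)` carrying the minimal-rate quantity `Λ^F|X_{i,F}(t)|(t⋆−t) ≥ 1/(32(3+Λ))` (such modes exist at every time along a blow-up,
`CriticalRate.typeOne_quantity_lower_bound`) has covariant viscosity `ν(1+ε₀)^{2F}(t⋆−t) < K₁`: the critical front never sits deep in the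
dissipation range, and the frame recentred at it (`isEternalVisc_recentre`) has BOUNDED viscosity.  MODEL lattice only.
[cite: Tao2016AveragedNS, §4 (4.3), proof of (4.13), the viscous equation before Thm. 4.2, §6.4; Teschl2012, §2.6; cell vocabulary (stmt-NavierStokesRegularity-20420)] -/
theorem frontClock_of_typeOne {R ε₀ ν : ℝ} (hε₀ : 0 < ε₀) (hν : 0 < ν)
    {α : Fin 4 → Fin 4 → Fin 4 → ℤ × ℤ × ℤ → ℝ} (hα : InTableClass R α) {X₀ : Fin 4 → ℝ}
    {X : Fin 4 → ℤ → ℝ → ℝ} {tStar : ℝ} (hV : ViscousUpTo ε₀ ν α X₀ X tStar) (hT1 : TypeOne ε₀ X tStar) :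
    ∃ K₁ t₁ : ℝ, 0 < K₁ ∧ t₁ < tStar ∧ ∀ t : ℝ, 0 ≤ t → t₁ ≤ t → t < tStar → ∀ (i : Fin 4) (F : ℤ),
      1 / (32 * (3 + bigLam ε₀)) ≤ bigLam ε₀ ^ F * |X i F t| * (tStar - t) →
        ν * (1 + ε₀) ^ ((2 : ℝ) * F) * (tStar - t) < K₁ := by
  have hl0 : (0 : ℝ) < 1 + ε₀ := by linarith
  have hΛ : 0 < bigLam ε₀ := bigLam_pos (by linarith)
  have hT : 0 < tStar := hV.pos
  obtain ⟨C₀, hC₀⟩ := hT1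
  set C : ℝ := max C₀ 0 with hCdef
  have hC : 0 ≤ C := le_max_right _ _
  have hTI : ∀ t : ℝ, 0 ≤ t → t < tStar → ∀ (i : Fin 4) (k : ℤ), bigLam ε₀ ^ k * |X i k t| * (tStar - t) ≤ C :=
    fun t ht0 htT i k => (hC₀ t ht0 htT i k).trans (le_max_left _ _)
  have hα1 : ∀ i₁ i₂ i₃ : Fin 4, |α i₁ i₂ i₃ (0, 0, 1)| ≤ 1 := fun i₁ i₂ i₃ =>
    abs_le_one_of_inTableClass hα i₁ i₂ i₃ _ (by rw [mem_shiftSet_iff]; simp)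
  set c : ℝ := 1 / (32 * (3 + bigLam ε₀)) with hcdef
  have hc : 0 < c := by rw [hcdef]; positivity
  have hc1 : c ≤ 1 := by
    rw [hcdef, div_le_one (by positivity)]; linarith
  obtain ⟨K₁, κ, hK₁, hκ0, hκ1, hdeep⟩ := renormalisedSq_lt_of_deepDissipation hε₀ hν.le hC hc hc1 hα.2.1 hα1
    hV.contDiffOn hV.motion hTI
  refine ⟨K₁, (1 - κ) * tStar, hK₁, by nlinarith, fun t ht0 ht1 htT i F hF => ?_⟩
  have hF0 : 0 ≤ F := by
    by_contra hneg
    push Not at hneg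
    rw [hV.noLow i F t hneg ht0 htT, abs_zero, mul_zero, zero_mul] at hF
    exact absurd hF (not_le.2 hc)
  obtain ⟨n, rfl⟩ := Int.eq_ofNat_of_zero_le hF0
  have hwin : tStar - t ≤ κ * tStar := by linarith
  by_contra hge
  push Not at hge
  have hge' : K₁ ≤ ν * (1 + ε₀) ^ (2 * n) * (tStar - t) := by
    have hw2 : (1 + ε₀) ^ ((2 : ℝ) * ((n : ℕ) : ℤ)) = (1 + ε₀) ^ (2 * n) := by
      rw [show (2 : ℝ) * (((n : ℕ) : ℤ) : ℝ) = ((2 * n : ℕ) : ℝ) by push_cast; ring, Real.rpow_natCast]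
    rw [hw2] at hge
    exact hge
  have hsmall := hdeep n t ht0 htT hwin hge'
  -- but the front mode gives `c² ≤ Λ^{2n}(t⋆-t)²‖X_n(t)‖²`
  have hcomp : bigLam ε₀ ^ (n : ℤ) * |X i (n : ℤ) t| * (tStar - t) ≤
      bigLam ε₀ ^ (n : ℤ) * ‖shellVec X (n : ℤ) t‖ * (tStar - t) :=
    mul_le_mul_of_nonneg_right (mul_le_mul_of_nonneg_left (abs_apply_le_norm_shellVec X (n : ℤ) t i)
      (zpow_nonneg hΛ.le _)) (by linarith)
  have hy : c ≤ bigLam ε₀ ^ (n : ℤ) * ‖shellVec X (n : ℤ) t‖ * (tStar - t) := hF.trans hcomp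
  have hsq : c ^ 2 ≤ (bigLam ε₀ ^ (n : ℤ) * ‖shellVec X (n : ℤ) t‖ * (tStar - t)) ^ 2 :=
    pow_le_pow_left₀ hc.le hy 2
  have hz : (bigLam ε₀ ^ (n : ℤ) * ‖shellVec X (n : ℤ) t‖ * (tStar - t)) ^ 2 =
      bigLam ε₀ ^ (2 * n) * (tStar - t) ^ 2 * ‖shellVec X (n : ℤ) t‖ ^ 2 := by
    rw [zpow_natCast, pow_mul]; ring
  rw [hz] at hsq
  exact absurd (lt_of_le_of_lt hsq hsmall) (lt_irrefl _)

/-- **LEVEL FLOOR AT THE CRITICAL FRONT (type I).**  In the situation of `frontClock_of_typeOne`, at every critical-front mode `(i,F)` at a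
time `t ∈ [t₁,t⋆)` the square root of the a=1 level is bounded BELOW: `(1+ε₀)^{F/2}|X_{i,F}(t)| > ν/(32(3+Λ)K₁)` — via the frame-viscosity
identity `ν(1+ε₀)^{2F}(t⋆−t)·((1+ε₀)^{F/2}|X_{i,F}|) = ν·(Λ^F|X_{i,F}|(t⋆−t))` and the upper clock.  So along a type-I viscous blow-up the
critical front carries a=1 level `≥ (ν/(32(3+Λ)K₁))²` at all late times: the recentred frames are fired at the anchor, uniformly.
MODEL lattice only.
[cite: Tao2016AveragedNS, §4 (4.1), the viscous equation before Thm. 4.2, §6.4; cell vocabulary (stmt-NavierStokesRegularity-20420)] -/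
theorem frontLevel_floor_of_typeOne {R ε₀ ν : ℝ} (hε₀ : 0 < ε₀) (hν : 0 < ν)
    {α : Fin 4 → Fin 4 → Fin 4 → ℤ × ℤ × ℤ → ℝ} (hα : InTableClass R α) {X₀ : Fin 4 → ℝ}
    {X : Fin 4 → ℤ → ℝ → ℝ} {tStar : ℝ} (hV : ViscousUpTo ε₀ ν α X₀ X tStar) (hT1 : TypeOne ε₀ X tStar) :
    ∃ K₁ t₁ : ℝ, 0 < K₁ ∧ t₁ < tStar ∧ ∀ t : ℝ, 0 ≤ t → t₁ ≤ t → t < tStar → ∀ (i : Fin 4) (F : ℤ),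
      1 / (32 * (3 + bigLam ε₀)) ≤ bigLam ε₀ ^ F * |X i F t| * (tStar - t) →
        ν / (32 * (3 + bigLam ε₀) * K₁) < (1 + ε₀) ^ ((F : ℝ) / 2) * |X i F t| := by
  have hl0 : (0 : ℝ) < 1 + ε₀ := by linarith
  have hε : (-1 : ℝ) < ε₀ := by linarith
  have hΛ : 0 < bigLam ε₀ := bigLam_pos hε
  obtain ⟨K₁, t₁, hK₁, ht₁, hclock⟩ := frontClock_of_typeOne hε₀ hν hα hV hT1
  refine ⟨K₁, t₁, hK₁, ht₁, fun t ht0 ht1 htT i F hF => ?_⟩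
  have hvis := hclock t ht0 ht1 htT i F hF
  set q : ℝ := (1 + ε₀) ^ ((F : ℝ) / 2) * |X i F t| with hqdef
  set v : ℝ := ν * (1 + ε₀) ^ ((2 : ℝ) * F) * (tStar - t) with hvdef
  have hq0 : 0 ≤ q := by rw [hqdef]; positivity
  have hv0 : 0 ≤ v := by
    rw [hvdef]; exact mul_nonneg (mul_nonneg hν.le (Real.rpow_nonneg hl0.le _)) (by linarith)
  -- the identity `v · q = ν · (Λ^F |X| (t⋆ - t))`
  have hid : v * q = ν * (bigLam ε₀ ^ F * |X i F t| * (tStar - t)) := by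
    have hP : bigLam ε₀ ^ F = (1 + ε₀) ^ ((2 : ℝ) * F) * (1 + ε₀) ^ ((F : ℝ) / 2) := by
      rw [bigLam, ← Real.rpow_intCast, ← Real.rpow_mul hl0.le, ← Real.rpow_add hl0]
      congr 1
      ring
    rw [hvdef, hqdef, hP]
    ring
  have hlow : ν * (1 / (32 * (3 + bigLam ε₀))) ≤ v * q := by
    rw [hid]; exact mul_le_mul_of_nonneg_left hF hν.le
  have h32 : 0 < 32 * (3 + bigLam ε₀) := by positivity
  rw [div_lt_iff₀ (mul_pos h32 hK₁)]
  -- `ν ≤ 32(3+Λ) · v q < 32(3+Λ) · K₁ q`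
  have h1 : ν ≤ 32 * (3 + bigLam ε₀) * (v * q) := by
    have := mul_le_mul_of_nonneg_left hlow h32.le
    have e : 32 * (3 + bigLam ε₀) * (ν * (1 / (32 * (3 + bigLam ε₀)))) = ν := by field_simp
    linarith
  have hqpos : 0 < q := by
    rcases lt_or_eq_of_le hq0 with h | h
    · exact h
    · rw [← h, mul_zero, mul_zero] at h1; linarith
  have h2 : v * q < K₁ * q := mul_lt_mul_of_pos_right hvis hqpos
  nlinarith [h1, h2, h32]

end Summit.NavierStokesRegularity.NavierStokesRegularity.Theorems.EternalRigidityViscBddOne.FrontClock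

end
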